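import Summits.BirchSwinnertonDyer.Rank1Residual.AdditivePotMult.TwistPointsOver
import HarnessLib

/-!
# (P5-1a) The square root `t = √c ∈ ℚ̄` of the twist parameter: `Γ_ℚ` moves `t` to `±t`, and the
# quadratic character `η : Γ_ℚ →* ℤˣ` cut out by `t` ([SIGN] of `cells/n1011/skel/T-O7ss-P5.md`)
(cell `b2b-bsdres`, team n1011, seat n1011-p17 GEN 7; row T-O7ss-P13 follow-up (P5), file P5-1a;
design (A) "one step over `K₀ ∋ θ`, sign rule keyed on `σ • rootInClosure K₀ θ = ± rootInClosure K₀ θ`"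
APPROVED by referee-1 GEN 22)

HONEST FRAMING (cell `b2b-bsdres`, run/shared/lean/b2b/bsd-rank1-residual/, verbatim in every
file): the goal of the cell is to DELETE the COMBINATION-SHAPED residual classes of the
Birch–Swinnerton-Dyer formula for ALL analytic-rank `≤ 1` elliptic curves over `ℚ` — "full BSD
formula for every rank `≤ 1` curve in class `C`" assembled STRICTLY from published theorems — so
that the rank-`≤ 1` remainder becomes exactly the CONSTRUCTION-SHAPED classes, which are TYPED
(missing-input `Prop`s), NOT attempted. This is not "finishing BSD". Research route on
O7-ss ∩ (G)∧ss ∩ e = 2 (OPEN) / X4 CONSTRUCTION-SHAPED; nothing here is booked; no label moves.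
TOOL THEOREMS ONLY: no definition, no named Literature fact, no `sorry`; axioms standard.

## What is proved

For a number field `K₀`, `θ ∈ K₀ ∖ ℚ` with `θ² = c ∈ ℚ`, and `t := rootInClosure K₀ θ ∈ ℚ̄`
(additive-p1's copy of `θ` in `ℚ̄`):
* `rootInClosure_ne_zero`, `rootInClosure_ne_neg` — `t ≠ 0`, `t ≠ −t`;
* `smul_rootInClosure_eq_or`, `smul_rootInClosure_eq_neg_iff` — every `σ ∈ Γ_ℚ` maps `t ↦ ±t`;
* `exists_eta_iff_smul_rootInClosure` — **[SIGN]** there is a homomorphism `η : Γ_ℚ →* ℤˣ` with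
  `η σ = 1 ↔ σ t = t`; for `K₀ = ℚ(μ_p)`, `θ² = p*` this is Kobayashi's `η = ω^{(p−1)/2}`, the
  character of `ℚ(√p*) ⊂ ℚ(μ_p)` — the shape of the binder `hη` of the (P5) dictionary.

No `[K₀ : ℚ] = 2` (additive-p1's `sigmaQ`/`galRange K` sign rule needs it; keying on `t` does not).

References: S. Kobayashi, Invent. Math. 152 (2003) §4 p. 8 (η-components) [Kobayashi2003];
T. Dokchitser, *Notes on the parity conjecture* (2013) §4 [Dokchitser2013ParityNotes].
-/

noncomputable section

open scoped Classical

open WeierstrassCurve Field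

namespace Summit.BirchSwinnertonDyer.Rank1Residual.Additive.SignedTwist

open Literature.NumberTheory.EllipticCurves Literature.NumberTheory.GaloisRepresentations
  Summit.BirchSwinnertonDyer.Rank1Residual.AdditivePotMult

/-! ## §0 The square root `t = rootInClosure K₀ θ ∈ ℚ̄`: every `σ ∈ Γ_ℚ` maps `t ↦ ±t`; [SIGN] -/

section Root

variable (K₀ : Type) [Field K₀] [NumberField K₀] {θ : K₀} {c : ℚ}
  (hθ : θ ∉ Set.range (algebraMap ℚ K₀)) (hc : θ ^ 2 = algebraMap ℚ K₀ c)

include hθ in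
/-- `t ≠ 0` (else `θ = 0 ∈ ℚ`). [folklore] -/
theorem rootInClosure_ne_zero : rootInClosure K₀ θ ≠ 0 := by
  intro h
  apply rootInClosure_not_mem K₀ hθ
  exact ⟨0, by rw [map_zero, h]⟩

include hθ in
/-- `t ≠ -t` (characteristic `0`). [folklore] -/
theorem rootInClosure_ne_neg : rootInClosure K₀ θ ≠ -rootInClosure K₀ θ := fun h ↦
  rootInClosure_ne_zero K₀ hθ (by
    have h2 : (2 : AlgebraicClosure ℚ) * rootInClosure K₀ θ = 0 := by
      rw [two_mul]; nth_rw 2 [h]; rw [add_neg_cancel]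
    exact (mul_eq_zero.mp h2).resolve_left two_ne_zero)

include hc in
/-- **Every `σ ∈ Γ_ℚ` maps `t` to `±t`**: `(σ t)² = σ(t²) = σ(c) = c = t²`. [folklore] -/
theorem smul_rootInClosure_eq_or (σ : absoluteGaloisGroup ℚ) :
    σ • rootInClosure K₀ θ = rootInClosure K₀ θ ∨ σ • rootInClosure K₀ θ = -rootInClosure K₀ θ := by
  apply sq_eq_sq_iff_eq_or_eq_neg.mp
  rw [← smul_pow', rootInClosure_sq K₀ hc]
  exact (show AlgebraicClosure ℚ ≃ₐ[ℚ] AlgebraicClosure ℚ from σ).commutes c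

include hθ hc in
/-- The dichotomy is exclusive. [folklore] -/
theorem smul_rootInClosure_eq_neg_iff (σ : absoluteGaloisGroup ℚ) :
    σ • rootInClosure K₀ θ = -rootInClosure K₀ θ ↔ σ • rootInClosure K₀ θ ≠ rootInClosure K₀ θ := by
  constructor
  · intro h h'
    exact rootInClosure_ne_neg K₀ hθ (h'.symm.trans h)
  · intro h
    exact (smul_rootInClosure_eq_or K₀ hc σ).resolve_left h

include hθ hc in
/-- **[SIGN] the quadratic character cut out by `t`**: there is a (unique) homomorphism
`η : Γ_ℚ →* ℤˣ` with `η σ = 1 ↔ σ t = t` (so `σ t = η(σ) t`); for `K₀ = ℚ(μ_p)`, `θ² = p*`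
this is Kobayashi's `η = ω^{(p−1)/2}`, the character of `ℚ(√p*) ⊂ ℚ(μ_p)`.
[cite: Kobayashi2003, §4 p. 8 (η-components)] -/
theorem exists_eta_iff_smul_rootInClosure :
    ∃ η : absoluteGaloisGroup ℚ →* ℤˣ,
      ∀ σ, η σ = 1 ↔ σ • rootInClosure K₀ θ = rootInClosure K₀ θ := by
  set t := rootInClosure K₀ θ with ht
  let f : absoluteGaloisGroup ℚ → ℤˣ := fun σ ↦ if σ • t = t then 1 else -1
  have hf : ∀ σ, (((f σ : ℤˣ) : ℤ) : AlgebraicClosure ℚ) * t = σ • t := by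
    intro σ
    by_cases h : σ • t = t
    · simp only [f, if_pos h, Units.val_one, Int.cast_one, one_mul, h]
    · simp only [f, if_neg h, Units.val_neg, Units.val_one, Int.cast_neg, Int.cast_one, neg_mul,
        one_mul]
      exact ((smul_rootInClosure_eq_neg_iff K₀ hθ hc σ).mpr h).symm
  have hne : ((((-1 : ℤˣ) : ℤ) : AlgebraicClosure ℚ)) * t ≠ ((((1 : ℤˣ) : ℤ) : AlgebraicClosure ℚ)) * t := by
    rw [Units.val_neg, Units.val_one, Int.cast_neg, Int.cast_one, neg_mul, one_mul]
    exact (rootInClosure_ne_neg K₀ hθ).symm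
  have hinj : ∀ u v : ℤˣ, (((u : ℤ) : AlgebraicClosure ℚ)) * t = (((v : ℤ) : AlgebraicClosure ℚ)) * t →
      u = v := by
    intro u v huv
    rcases Int.units_eq_one_or u with rfl | rfl <;> rcases Int.units_eq_one_or v with rfl | rfl
    · rfl
    · exact absurd huv.symm hne
    · exact absurd huv hne
    · rfl
  refine ⟨MonoidHom.mk' f fun σ τ ↦ hinj _ _ ?_, fun σ ↦ ?_⟩
  · rw [hf, mul_smul, ← hf τ, smul_mul', ← hf σ, Units.val_mul, Int.cast_mul]
    have : σ • ((((f τ : ℤˣ) : ℤ) : AlgebraicClosure ℚ)) = (((f τ : ℤˣ) : ℤ) : AlgebraicClosure ℚ) := by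
      rw [← map_intCast (algebraMap ℚ (AlgebraicClosure ℚ)), ]
      exact (show AlgebraicClosure ℚ ≃ₐ[ℚ] AlgebraicClosure ℚ from σ).commutes _
    rw [this]; ring
  · change f σ = 1 ↔ σ • t = t
    constructor
    · intro h1
      have := hf σ
      rw [h1, Units.val_one, Int.cast_one, one_mul] at this
      exact this.symm
    · intro h
      simp only [f, if_pos h]

variable (η : absoluteGaloisGroup ℚ →* ℤˣ)
  (hη : ∀ σ : absoluteGaloisGroup ℚ, η σ = 1 ↔ σ • rootInClosure K₀ θ = rootInClosure K₀ θ)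

include hθ hc hη in
/-- `η σ = −1` exactly when `σ t = −t`. [folklore] -/
theorem eta_eq_neg_one_iff (σ : absoluteGaloisGroup ℚ) :
    η σ = -1 ↔ σ • rootInClosure K₀ θ = -rootInClosure K₀ θ := by
  rw [smul_rootInClosure_eq_neg_iff K₀ hθ hc]
  constructor
  · intro h h1
    rw [(hη σ).mpr h1] at h
    exact absurd h (by decide)
  · intro h
    exact (Int.units_eq_one_or (η σ)).resolve_left fun h1 ↦ h ((hη σ).mp h1)

end Root

end Summit.BirchSwinnertonDyer.Rank1Residual.Additive.SignedTwist
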